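/- Width seat 2/3 `ym-line-cbag-p1-w2` (prover-ym-line-cbag-p1-w2-g21-0) of the cell of ideator ym-idea-2, LINE 8
(route `EguchiKawaiDirectionLadder`), post-closure glue for the barrier entry `EguchiKawaiBreakdown` (crux
stmt-QuantumFields-27724, CLOSED·proved): the FINITE-TORUS ENGINE behind "in `d = 2` every open Wilson word of the Eguchi–Kawai
model vanishes at every coupling" (`EguchiKawaiDirectionLadderWilsonWordsTwoDim.lean`).  Route-independent.  HONEST FRAMING:
single-site-model algebra; the Yang–Mills mass gap / the summit `YangMills` is NOT proved or advanced. -/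
import Summits.QuantumFields.YangMills.Theorems.EguchiKawaiDirectionLadderWilsonWords
import Summits.QuantumFields.YangMills.Theorems.EguchiKawaiDirectionLadderWilsonWordsTwoDimAveraging
import Literature.Barriers.QuantumFields.EguchiKawaiBreakdownProofs
import Literature.LinearAlgebra.Matrix.UnitaryGroupMaximalTorus
import Mathlib.Analysis.SpecialFunctions.Complex.CircleAddChar
import HarnessLib

/-!
# Wilson words along the conjugate finite torus (engine for the `d = 2` vanishing of open words)

Fix two links `A, V ∈ U(N)`, a unitary `P` and a modulus `M`.  Along the finite torus `m ∈ (ZMod M)^N` consider the rotated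
second link `D_m V`, `D_m = P·diag(ζ(m_1), …, ζ(m_N))·P⁻¹` (`ζ = ZMod.toCircle`, the `M`-th roots of unity), and the trace
`F(m) = tr W_l(A, D_m V)` of a word `l` (letters in `Fin 2 × Bool`).  This file proves

* `norm_trace_mul_ekWordMatrix_sub_mul_le` — **test-form telescoping** (any `d`): if two configurations differ only at the link
  `ν` and `|tr(Y (U'_ν − U_ν) Z)| ≤ K` for all unitary `Y, Z`, then `|tr(Y (W_l(U') − W_l(U)) Z)| ≤ wordMult l ν · K`;
* `norm_trace_torus_update_sub_le` — changing ONE coordinate of the torus parameter is a RANK-ONE perturbation: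
  `|tr(Y (D_{z[c↦w]} V − D_z V) Z)| ≤ |w − z_c|` (`= |w − z_c| · |(P⁻¹ V Z Y P)_cc|`);
* `norm_wordTrace_update_sub_le` — hence `|F(m[c ↦ a]) − F(m)| ≤ wordMult l 1 · |ζ(a) − ζ(m_c)|`;
* `sum_wordTrace_eq_zero` — MEAN ZERO: `Σ_m F(m) = 0` when `M ∤ q` (`q = wordCharge l 1`): the global rotation `m ↦ m + 1`
  multiplies `F` by `ω^{n₊} ω̄^{n₋} = ω^q ≠ 1` (phase covariance, Makeenko (14.48));
* `sum_normSq_wordTrace_le` — with the Efron–Stein inequality of `…TwoDimAveraging` and `Σ_a |ζ(a) − ζ(b)|² = 2M`: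
  `Σ_m |F(m)|² ≤ 2 N (wordMult l 1)² · M^N`.

The commutation `D_z A = A D_z` for `P⁻¹AP` diagonal (`conj_torus_mul_comm`) is what makes the weight of the `d = 2` model
invariant under `V ↦ D_z V`; that step and the integration are in `EguchiKawaiDirectionLadderWilsonWordsTwoDim.lean`.
References: Y. Makeenko, *Methods of Contemporary Gauge Theory* (CUP 2023) §14.3–§14.4 (PDF pp. 245–250).
-/

set_option autoImplicit false

noncomputable section

open scoped Matrix ComplexConjugate BigOperators RealInnerProductSpace
open Matrix Complex MeasureTheory Filter Topology
open Literature.Barriers.QuantumFields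
open Literature.LinearAlgebra.Matrix (diagonalTorus mem_diagonalTorus_iff exists_conj_mem_diagonalTorus
  mul_comm_of_mem_diagonalTorus diagonalTorusHom coe_diagonalTorusHom_apply)

namespace Summit.QuantumFields.YangMills.Theorems.EguchiKawaiDirectionLadder

variable {d N : ℕ}

/-! ### §1  Rank-one telescoping in test form -/

/-- `|tr(Y Xᴴ Z)| = |tr(Zᴴ X Yᴴ)|` (conjugate transpose inside the trace). -/
theorem norm_trace_conjTranspose_sandwich (Y X Z : Matrix (Fin N) (Fin N) ℂ) :
    ‖(Y * Xᴴ * Z).trace‖ = ‖(Zᴴ * X * Yᴴ).trace‖ := by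
  have h : (Y * Xᴴ * Z)ᴴ = Zᴴ * X * Yᴴ := by
    rw [conjTranspose_mul, conjTranspose_mul, conjTranspose_conjTranspose, ← Matrix.mul_assoc]
  rw [← h, trace_conjTranspose, norm_star]

/-- **Test-form telescoping.**  If two configurations agree off the direction `ν` and the change of the link `ν` is
small IN TEST FORM — `‖tr (Y (U'_ν − U_ν) Z)‖ ≤ K` for all unitary `Y, Z` — then every word changes by at most
`wordMult l ν · K` in test form (each occurrence of `U_ν^{±1}` contributes one term `Y' (U'_ν − U_ν)^{(ᴴ)} Z'` with unitary
cofactors).  This is the rank-one substitute for the Frobenius telescoping `frobNorm_ekWordMatrix_sub_le`. -/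
theorem norm_trace_mul_ekWordMatrix_sub_mul_le (ν : Fin d) {U U' : EKConfig d N} (hU : ∀ μ, μ ≠ ν → U' μ = U μ)
    {K : ℝ} (hK : ∀ Y Z : Matrix (Fin N) (Fin N) ℂ, Y ∈ Matrix.unitaryGroup (Fin N) ℂ →
      Z ∈ Matrix.unitaryGroup (Fin N) ℂ →
        ‖(Y * (((U' ν : UN N) : Matrix (Fin N) (Fin N) ℂ) - ((U ν : UN N) : Matrix (Fin N) (Fin N) ℂ)) * Z).trace‖ ≤ K)
    (l : List (Fin d × Bool)) :
    ∀ Y Z : Matrix (Fin N) (Fin N) ℂ, Y ∈ Matrix.unitaryGroup (Fin N) ℂ → Z ∈ Matrix.unitaryGroup (Fin N) ℂ →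
      ‖(Y * (ekWordMatrix l U' - ekWordMatrix l U) * Z).trace‖ ≤ (wordMult l ν : ℝ) * K := by
  induction l with
  | nil =>
      intro Y Z _ _
      simp [wordMult]
  | cons a l ih =>
      intro Y Z hY hZ
      obtain ⟨ν', ε⟩ := a
      have hsplit : Y * (ekWordMatrix ((ν', ε) :: l) U' - ekWordMatrix ((ν', ε) :: l) U) * Z =
          Y * ekLetterMatrix U' (ν', ε) * (ekWordMatrix l U' - ekWordMatrix l U) * Z +
            Y * (ekLetterMatrix U' (ν', ε) - ekLetterMatrix U (ν', ε)) * (ekWordMatrix l U * Z) := by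
        simp only [ekWordMatrix_cons]
        noncomm_ring
      have hL' : ekLetterMatrix U' (ν', ε) ∈ Matrix.unitaryGroup (Fin N) ℂ := ekLetterMatrix_mem_unitaryGroup U' _
      have hW : ekWordMatrix l U ∈ Matrix.unitaryGroup (Fin N) ℂ := ekWordMatrix_mem_unitaryGroup l U
      have h1 := ih (Y * ekLetterMatrix U' (ν', ε)) Z (mul_mem hY hL') hZ
      -- the letter term
      have h2 : ‖(Y * (ekLetterMatrix U' (ν', ε) - ekLetterMatrix U (ν', ε)) * (ekWordMatrix l U * Z)).trace‖ ≤
          (if ν' = ν then 1 else 0 : ℝ) * K := by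
        by_cases h : ν' = ν
        · subst h
          rw [if_pos rfl, one_mul]
          cases ε with
          | true =>
              simpa [ekLetterMatrix] using hK Y (ekWordMatrix l U * Z) hY (mul_mem hW hZ)
          | false =>
              have hX : ekLetterMatrix U' (ν', false) - ekLetterMatrix U (ν', false) =
                  (((U' ν' : UN N) : Matrix (Fin N) (Fin N) ℂ) - ((U ν' : UN N) : Matrix (Fin N) (Fin N) ℂ))ᴴ := by
                simp [ekLetterMatrix, conjTranspose_sub]
              rw [hX, norm_trace_conjTranspose_sandwich]
              refine hK _ _ ?_ ?_
              · simpa [star_eq_conjTranspose] using Unitary.star_mem (mul_mem hW hZ)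
              · simpa [star_eq_conjTranspose] using Unitary.star_mem hY
        · have hsame : ekLetterMatrix U' (ν', ε) = ekLetterMatrix U (ν', ε) := by
            simp [ekLetterMatrix, hU ν' h]
          rw [if_neg h, zero_mul, hsame, sub_self]
          simp
      have hcount : (wordMult ((ν', ε) :: l) ν : ℝ) = wordMult l ν + (if ν' = ν then 1 else 0 : ℝ) := by
        by_cases h : ν' = ν <;> simp [wordMult, h]
      rw [hsplit, trace_add, hcount, add_mul]
      exact (norm_add_le _ _).trans (add_le_add h1 h2)

/-! ### §2  The conjugate torus acting on the second link -/

/-- An element of the diagonal torus parametrised by `U(1)^N`. -/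
theorem diagonalTorusHom_mem (z : Fin N → Circle) : diagonalTorusHom (Fin N) z ∈ diagonalTorus (Fin N) :=
  ⟨fun i => (z i : ℂ), coe_diagonalTorusHom_apply (Fin N) z⟩

/-- If `P⁻¹ A P` is diagonal, the conjugate torus `P·diag(z)·P⁻¹` commutes with `A`. -/
theorem conj_torus_mul_comm {P A : UN N} (hA : P⁻¹ * A * P ∈ diagonalTorus (Fin N)) (z : Fin N → Circle) :
    P * diagonalTorusHom (Fin N) z * P⁻¹ * A = A * (P * diagonalTorusHom (Fin N) z * P⁻¹) := by
  have hc := mul_comm_of_mem_diagonalTorus (diagonalTorusHom_mem z) hA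
  calc P * diagonalTorusHom (Fin N) z * P⁻¹ * A = P * (diagonalTorusHom (Fin N) z * (P⁻¹ * A * P)) * P⁻¹ := by group
    _ = P * ((P⁻¹ * A * P) * diagonalTorusHom (Fin N) z) * P⁻¹ := by rw [hc]
    _ = A * (P * diagonalTorusHom (Fin N) z * P⁻¹) := by group

/-- A diagonal sum against a one-point function: `Σ_i single_c(t)_i · x_i = t · x_c`. -/
theorem sum_single_mul (c : Fin N) (t : ℂ) (x : Fin N → ℂ) :
    ∑ i, (Pi.single c t : Fin N → ℂ) i * x i = t * x c := by
  rw [Finset.sum_eq_single c]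
  · rw [Pi.single_eq_same]
  · intro i _ hi; rw [Pi.single_eq_of_ne hi, zero_mul]
  · intro h; exact absurd (Finset.mem_univ c) h

/-- **The rank-one bound in test form.**  Changing one coordinate of the torus parameter, `z ↦ z[c ↦ w]`, changes the
rotated link `P·diag(z)·P⁻¹·V` by `(w − z_c) · P E_cc P⁻¹ V`, and `|tr(Y · P E_cc P⁻¹ V · Z)| = |(P⁻¹ V Z Y P)_cc| ≤ 1` for
unitary `Y, Z`. -/
theorem norm_trace_torus_update_sub_le (P V : UN N) (z : Fin N → Circle) (c : Fin N) (w : Circle)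
    (Y Z : Matrix (Fin N) (Fin N) ℂ) (hY : Y ∈ Matrix.unitaryGroup (Fin N) ℂ) (hZ : Z ∈ Matrix.unitaryGroup (Fin N) ℂ) :
    ‖(Y * (((P * diagonalTorusHom (Fin N) (Function.update z c w) * P⁻¹ * V : UN N) : Matrix (Fin N) (Fin N) ℂ) -
        ((P * diagonalTorusHom (Fin N) z * P⁻¹ * V : UN N) : Matrix (Fin N) (Fin N) ℂ)) * Z).trace‖ ≤
      ‖(w : ℂ) - z c‖ := by
  -- the difference of the two diagonal matrices is `diag(single_c (w − z_c))`
  have hδ : (fun i => ((Function.update z c w i : Circle) : ℂ) - ((z i : Circle) : ℂ)) =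
      (Pi.single c ((w : ℂ) - z c) : Fin N → ℂ) := by
    funext i
    by_cases h : i = c
    · subst h; simp
    · simp [Function.update_of_ne h, Pi.single_eq_of_ne h]
  have hdiff : ((P * diagonalTorusHom (Fin N) (Function.update z c w) * P⁻¹ * V : UN N) : Matrix (Fin N) (Fin N) ℂ) -
      ((P * diagonalTorusHom (Fin N) z * P⁻¹ * V : UN N) : Matrix (Fin N) (Fin N) ℂ) =
        (P : Matrix (Fin N) (Fin N) ℂ) * diagonal (Pi.single c ((w : ℂ) - z c) : Fin N → ℂ) *
          ((P⁻¹ : UN N) : Matrix (Fin N) (Fin N) ℂ) * (V : Matrix (Fin N) (Fin N) ℂ) := by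
    simp only [Matrix.UnitaryGroup.mul_val, coe_diagonalTorusHom_apply]
    rw [← Matrix.sub_mul, ← Matrix.sub_mul, ← Matrix.mul_sub, diagonal_sub, hδ]
  set X : Matrix (Fin N) (Fin N) ℂ :=
    ((P⁻¹ : UN N) : Matrix (Fin N) (Fin N) ℂ) * (V : Matrix (Fin N) (Fin N) ℂ) * Z * Y * (P : Matrix (Fin N) (Fin N) ℂ)
    with hX
  have hXu : X ∈ Matrix.unitaryGroup (Fin N) ℂ :=
    mul_mem (mul_mem (mul_mem (mul_mem (P⁻¹).2 V.2) hZ) hY) P.2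
  have hcyc : (Y * ((P : Matrix (Fin N) (Fin N) ℂ) * diagonal (Pi.single c ((w : ℂ) - z c) : Fin N → ℂ) *
      ((P⁻¹ : UN N) : Matrix (Fin N) (Fin N) ℂ) * (V : Matrix (Fin N) (Fin N) ℂ)) * Z).trace =
        (diagonal (Pi.single c ((w : ℂ) - z c) : Fin N → ℂ) * X).trace := by
    have h1 : Y * ((P : Matrix (Fin N) (Fin N) ℂ) * diagonal (Pi.single c ((w : ℂ) - z c) : Fin N → ℂ) *
        ((P⁻¹ : UN N) : Matrix (Fin N) (Fin N) ℂ) * (V : Matrix (Fin N) (Fin N) ℂ)) * Z =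
          (Y * (P : Matrix (Fin N) (Fin N) ℂ)) * (diagonal (Pi.single c ((w : ℂ) - z c) : Fin N → ℂ) *
            (((P⁻¹ : UN N) : Matrix (Fin N) (Fin N) ℂ) * (V : Matrix (Fin N) (Fin N) ℂ) * Z)) := by
      simp only [Matrix.mul_assoc]
    have h2 : diagonal (Pi.single c ((w : ℂ) - z c) : Fin N → ℂ) * X =
        (diagonal (Pi.single c ((w : ℂ) - z c) : Fin N → ℂ) *
          (((P⁻¹ : UN N) : Matrix (Fin N) (Fin N) ℂ) * (V : Matrix (Fin N) (Fin N) ℂ) * Z)) *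
            (Y * (P : Matrix (Fin N) (Fin N) ℂ)) := by
      simp only [hX, Matrix.mul_assoc]
    rw [h1, trace_mul_comm, ← h2]
  have htr : (diagonal (Pi.single c ((w : ℂ) - z c) : Fin N → ℂ) * X).trace = ((w : ℂ) - z c) * X c c := by
    simp only [Matrix.trace, Matrix.diag_apply, diagonal_mul]
    exact sum_single_mul c _ _
  rw [hdiff, hcyc, htr, norm_mul]
  have hentry : ‖X c c‖ ≤ 1 := norm_entry_le_one ⟨X, hXu⟩ c c
  calc ‖(w : ℂ) - z c‖ * ‖X c c‖ ≤ ‖(w : ℂ) - z c‖ * 1 := mul_le_mul_of_nonneg_left hentry (norm_nonneg _)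
    _ = ‖(w : ℂ) - z c‖ := mul_one _

/-! ### §3  The word along the finite torus `(ZMod M)^N`: Lipschitz in each coordinate, mean zero -/

section Torus

variable {M : ℕ} [NeZero M]

/-- **Lipschitz in each torus coordinate (rank one).**  For the word of the pair `(A, P·diag(ζ(m))·P⁻¹·V)`,
`ζ = ZMod.toCircle`, changing the coordinate `c` of `m` to `a` changes the trace by at most `wordMult l 1 · |ζ(a) − ζ(m_c)|`. -/
theorem norm_wordTrace_update_sub_le (P A V : UN N) (l : List (Fin 2 × Bool)) (m : Fin N → ZMod M) (c : Fin N)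
    (a : ZMod M) :
    ‖(ekWordMatrix l (![A, P * diagonalTorusHom (Fin N) (fun i => ZMod.toCircle (Function.update m c a i)) * P⁻¹ * V] :
          EKConfig 2 N)).trace -
        (ekWordMatrix l (![A, P * diagonalTorusHom (Fin N) (fun i => ZMod.toCircle (m i)) * P⁻¹ * V] :
          EKConfig 2 N)).trace‖ ≤
      (wordMult l 1 : ℝ) * ‖((ZMod.toCircle a : Circle) : ℂ) - (ZMod.toCircle (m c) : Circle)‖ := by
  have hupd : (fun i => (ZMod.toCircle (Function.update m c a i) : Circle)) =
      Function.update (fun i => (ZMod.toCircle (m i) : Circle)) c (ZMod.toCircle a) := by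
    funext i
    exact Function.apply_update (fun _ => (ZMod.toCircle : ZMod M → Circle)) m c a i
  rw [hupd]
  set z : Fin N → Circle := fun i => ZMod.toCircle (m i) with hz
  set U : EKConfig 2 N := ![A, P * diagonalTorusHom (Fin N) z * P⁻¹ * V] with hUdef
  set U' : EKConfig 2 N := ![A, P * diagonalTorusHom (Fin N) (Function.update z c (ZMod.toCircle a)) * P⁻¹ * V]
    with hU'def
  have hU : ∀ μ : Fin 2, μ ≠ 1 → U' μ = U μ := by
    intro μ hμ
    fin_cases μ
    · simp [hUdef, hU'def]
    · exact absurd rfl hμ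
  have h1' : U' 1 = P * diagonalTorusHom (Fin N) (Function.update z c (ZMod.toCircle a)) * P⁻¹ * V := by
    simp [hU'def]
  have h1 : U 1 = P * diagonalTorusHom (Fin N) z * P⁻¹ * V := by
    simp [hUdef]
  have hK : ∀ Y Z : Matrix (Fin N) (Fin N) ℂ, Y ∈ Matrix.unitaryGroup (Fin N) ℂ → Z ∈ Matrix.unitaryGroup (Fin N) ℂ →
      ‖(Y * (((U' 1 : UN N) : Matrix (Fin N) (Fin N) ℂ) - ((U 1 : UN N) : Matrix (Fin N) (Fin N) ℂ)) * Z).trace‖ ≤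
        ‖((ZMod.toCircle a : Circle) : ℂ) - (z c : ℂ)‖ := by
    intro Y Z hY hZ
    rw [h1', h1]
    exact norm_trace_torus_update_sub_le P V z c (ZMod.toCircle a) Y Z hY hZ
  have h := norm_trace_mul_ekWordMatrix_sub_mul_le (1 : Fin 2) hU hK l 1 1 (Submonoid.one_mem _) (Submonoid.one_mem _)
  rw [Matrix.one_mul, Matrix.mul_one, trace_sub] at h
  exact h

/-- `ζ(1) = e^{2πi/M}` is the tree's `centerRoot M`. -/
theorem coe_toCircle_one : ((ZMod.toCircle (1 : ZMod M) : Circle) : ℂ) = centerRoot M := by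
  rw [← Nat.cast_one, ZMod.toCircle_natCast, centerRoot]
  push_cast
  ring_nf

/-- The scalar matrix `diag(ω, …, ω) = ω • 1`. -/
theorem diagonal_const_eq_smul_one (ω : ℂ) : (diagonal fun _ : Fin N => ω) = ω • (1 : Matrix (Fin N) (Fin N) ℂ) := by
  ext i j
  by_cases h : i = j
  · subst h; simp
  · simp [h]

/-- **Global rotation of the torus parameter.**  Shifting every coordinate of `m` by `1` multiplies the rotated link by the
phase `ω = e^{2πi/M}`: `P·diag(ζ(m+1))·P⁻¹·V = ω · P·diag(ζ(m))·P⁻¹·V`. -/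
theorem coe_torus_shift (P V : UN N) (m : Fin N → ZMod M) :
    ((P * diagonalTorusHom (Fin N) (fun i => ZMod.toCircle ((m + 1) i)) * P⁻¹ * V : UN N) : Matrix (Fin N) (Fin N) ℂ) =
      centerRoot M • ((P * diagonalTorusHom (Fin N) (fun i => ZMod.toCircle (m i)) * P⁻¹ * V : UN N) :
        Matrix (Fin N) (Fin N) ℂ) := by
  have hz : (fun i => (ZMod.toCircle ((m + 1) i) : Circle)) =
      (fun i => (ZMod.toCircle (m i) : Circle)) * fun _ => ZMod.toCircle (1 : ZMod M) := by
    funext i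
    simp only [Pi.add_apply, Pi.one_apply, Pi.mul_apply]
    exact AddChar.map_add_eq_mul _ _ _
  have hω : ((diagonalTorusHom (Fin N) (fun _ : Fin N => ZMod.toCircle (1 : ZMod M)) : UN N) :
      Matrix (Fin N) (Fin N) ℂ) = centerRoot M • (1 : Matrix (Fin N) (Fin N) ℂ) := by
    rw [coe_diagonalTorusHom_apply]
    simp only [coe_toCircle_one]
    exact diagonal_const_eq_smul_one _
  rw [hz, map_mul]
  simp only [Matrix.UnitaryGroup.mul_val, hω]
  rw [Matrix.mul_smul, Matrix.mul_one, Matrix.mul_smul, Matrix.smul_mul, Matrix.smul_mul]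

/-- **Mean zero.**  If `M ∤ q` (`q` the winding of the word in the `V`-direction), the sum of the traces of the word over the
finite torus `(ZMod M)^N` vanishes: the global rotation reindexes the sum and multiplies it by `ω^{n₊} ω̄^{n₋} = ω^q ≠ 1`. -/
theorem sum_wordTrace_eq_zero (P A V : UN N) {l : List (Fin 2 × Bool)} (hq : ¬ ((M : ℤ) ∣ wordCharge l 1)) :
    ∑ m : Fin N → ZMod M, (ekWordMatrix l
        (![A, P * diagonalTorusHom (Fin N) (fun i => ZMod.toCircle (m i)) * P⁻¹ * V] : EKConfig 2 N)).trace = 0 := by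
  set F : (Fin N → ZMod M) → ℂ := fun m => (ekWordMatrix l
      (![A, P * diagonalTorusHom (Fin N) (fun i => ZMod.toCircle (m i)) * P⁻¹ * V] : EKConfig 2 N)).trace with hF
  set ρ : ℂ := centerRoot M ^ wordPlus l 1 * conj (centerRoot M) ^ wordMinus l 1 with hρ
  -- phase covariance under the global rotation
  have hshift : ∀ m, F (m + 1) = ρ * F m := by
    intro m
    have hc : ∀ ν : Fin 2,
        (((![A, P * diagonalTorusHom (Fin N) (fun i => ZMod.toCircle ((m + 1) i)) * P⁻¹ * V] : EKConfig 2 N) ν : UN N) :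
            Matrix (Fin N) (Fin N) ℂ) =
          (if ν = (1 : Fin 2) then centerRoot M else 1) •
            (((![A, P * diagonalTorusHom (Fin N) (fun i => ZMod.toCircle (m i)) * P⁻¹ * V] : EKConfig 2 N) ν : UN N) :
              Matrix (Fin N) (Fin N) ℂ) := by
      intro ν
      fin_cases ν
      · simp
      · simpa using coe_torus_shift P V m
    have hph := ekWordMatrix_phase (d := 2) (N := N) hc l
    rw [hF]
    simp only
    rw [hph, phaseProd_centerRotate (N := M) (1 : Fin 2) l, trace_smul, smul_eq_mul]
  have hρ1 : ρ ≠ 1 := centerPhase_ne_one (N := M) (NeZero.ne M) hq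
  -- reindex the sum by the rotation
  have hsum : ∑ m, F m = ρ * ∑ m, F m := by
    calc ∑ m, F m = ∑ m, F (m + 1) :=
          (Fintype.sum_equiv (Equiv.addRight (1 : Fin N → ZMod M)) (fun m => F (m + 1)) F fun m => rfl).symm
      _ = ρ * ∑ m, F m := by rw [Finset.mul_sum]; exact Finset.sum_congr rfl fun m _ => hshift m
  exact eq_zero_of_mul_eq_self_left hρ1 hsum.symm

/-- `ζ` is non-trivial for `M ≥ 2`: `Σ_{a ∈ ZMod M} ζ(a) = 0`. -/
theorem sum_coe_toCircle_eq_zero (hM : 2 ≤ M) : ∑ a : ZMod M, ((ZMod.toCircle a : Circle) : ℂ) = 0 := by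
  have h : (ZMod.stdAddChar : AddChar (ZMod M) ℂ) ≠ 0 := by
    intro h0
    have h1 : (ZMod.stdAddChar : AddChar (ZMod M) ℂ) 1 = 1 := by rw [h0]; rfl
    rw [ZMod.stdAddChar_apply, coe_toCircle_one] at h1
    exact centerRoot_ne_one hM h1
  have := AddChar.sum_eq_zero_iff_ne_zero.2 h
  simpa [ZMod.stdAddChar_apply] using this

/-- The squared chordal distances from one `M`-th root of unity to all of them add up to `2M` (`M ≥ 2`). -/
theorem sum_norm_toCircle_sub_sq (hM : 2 ≤ M) (b : ZMod M) :
    ∑ a : ZMod M, ‖((ZMod.toCircle a : Circle) : ℂ) - (ZMod.toCircle b : Circle)‖ ^ 2 = 2 * M := by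
  simp_rw [norm_sub_sq_real, Circle.norm_coe, one_pow]
  rw [Finset.sum_add_distrib, Finset.sum_sub_distrib, ← Finset.mul_sum, ← sum_inner, sum_coe_toCircle_eq_zero hM,
    inner_zero_left, mul_zero, sub_zero, Finset.sum_const, Finset.card_univ, ZMod.card]
  simp only [nsmul_eq_mul, mul_one]
  ring

/-- **The finite-torus bound.**  `Σ_m |tr W(A, D_{ζ(m)} V)|² ≤ 2 N (wordMult l 1)² · M^N` when `M ∤ q`, `M ≥ 2`:
Efron–Stein for the mean-zero function `F`, the rank-one Lipschitz bound in each coordinate, and `Σ_a |ζ(a) − ζ(b)|² = 2M`. -/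
theorem sum_normSq_wordTrace_le (hM : 2 ≤ M) (P A V : UN N) {l : List (Fin 2 × Bool)}
    (hq : ¬ ((M : ℤ) ∣ wordCharge l 1)) :
    ∑ m : Fin N → ZMod M, ‖(ekWordMatrix l
        (![A, P * diagonalTorusHom (Fin N) (fun i => ZMod.toCircle (m i)) * P⁻¹ * V] : EKConfig 2 N)).trace‖ ^ 2 ≤
      2 * N * (wordMult l 1 : ℝ) ^ 2 * Fintype.card (Fin N → ZMod M) := by
  set F : (Fin N → ZMod M) → ℂ := fun m => (ekWordMatrix l
      (![A, P * diagonalTorusHom (Fin N) (fun i => ZMod.toCircle (m i)) * P⁻¹ * V] : EKConfig 2 N)).trace with hF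
  have h0 : ∑ m, F m = 0 := sum_wordTrace_eq_zero P A V hq
  have hES := FiniteAveraging.sum_norm_sq_le_of_sum_eq_zero (E := ℂ) F h0
  have hMpos : (0 : ℝ) < M := by exact_mod_cast (show 0 < M by omega)
  -- each one-coordinate sum of squared increments is at most `m² · 2M`
  have hcoord : ∀ (c : Fin N) (m : Fin N → ZMod M),
      ∑ a, ‖F (Function.update m c a) - F m‖ ^ 2 ≤ (wordMult l 1 : ℝ) ^ 2 * (2 * M) := by
    intro c m
    rw [← sum_norm_toCircle_sub_sq hM (m c), Finset.mul_sum]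
    refine Finset.sum_le_sum fun a _ => ?_
    rw [← mul_pow]
    have hlip := norm_wordTrace_update_sub_le P A V l m c a
    exact pow_le_pow_left₀ (norm_nonneg _) hlip 2
  calc ∑ m, ‖F m‖ ^ 2
      ≤ (Fintype.card (ZMod M) : ℝ)⁻¹ * ∑ c : Fin N, ∑ m, ∑ a, ‖F (Function.update m c a) - F m‖ ^ 2 := hES
    _ ≤ (Fintype.card (ZMod M) : ℝ)⁻¹ *
          ∑ _c : Fin N, ∑ _m : Fin N → ZMod M, (wordMult l 1 : ℝ) ^ 2 * (2 * M) :=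
        mul_le_mul_of_nonneg_left (Finset.sum_le_sum fun c _ => Finset.sum_le_sum fun m _ => hcoord c m)
          (by positivity)
    _ = 2 * N * (wordMult l 1 : ℝ) ^ 2 * Fintype.card (Fin N → ZMod M) := by
        have hM0 : (M : ℝ) ≠ 0 := hMpos.ne'
        rw [ZMod.card, Finset.sum_const, Finset.sum_const, Finset.card_univ, Finset.card_univ, Fintype.card_fin]
        simp only [nsmul_eq_mul]
        rw [inv_mul_eq_div, div_eq_iff hM0]
        ring

end Torus

end Summit.QuantumFields.YangMills.Theorems.EguchiKawaiDirectionLadder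

end
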